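import Summits.AtomisticToContinuum.Crystallization.Theorems.FrustratedLawDichotomyGSCDensitySurgeryTest
import Summits.AtomisticToContinuum.Crystallization.Theorems.FrustratedLawDichotomyGSCSurgeryCertificates

/-!
# FrustratedLawDichotomy · crux `AperiodicFrustratedLawGap` (stmt-AtomisticToContinuum-27623) — THE `e⋆`-FREE SURGERY TEST, TRUNCATED
# (finite-range certificate form for census instruments; decomp-a2c, prover hand 2, structural share, generation 6)

Finite-range form of `FrustratedLawDichotomyGSCDensitySurgeryTest.not_isMuGSC_eStar_of_surgery_at_density`: the field terms of the surgery
balance are truncated at radius `Rc ≥ δ` and loaded with the explicit tail `T(δ, Rc) = (δ⁻⁶/12 + 1/6)·1024/(δ³Rc³)` per term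
(`FrustratedLawDichotomyGSCSurgeryCertificates.not_isMuGSC_of_truncated_surgery`, any `μ`), and the chemical potential is the candidate's own
van Hove energy density `μc` (`energyDensity_eq_eStar`).  So a census instrument certifies «candidate `X` is not an `e⋆`-μ-ground-state
configuration of Lennard-Jones» from FINITELY MANY distances and with NO bound on `e⋆`:

* `not_isMuGSC_eStar_of_truncated_surgery_at_density`.

(This module imports the g5 certificates file and therefore sits in the `GrainCoreNetworkSplit` import cone.)  All `[folklore]`.
-/

noncomputable section

namespace Summit.AtomisticToContinuum.Crystallization.Theorems.FrustratedLawDichotomyGSCDensityTruncatedTest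

open Filter Topology
open Literature.MathematicalPhysics.StatisticalMechanics
open Summit.AtomisticToContinuum.Crystallization.Theorems.ChargedEnergyGapNegative (E3 eStar)
open Summit.AtomisticToContinuum.Crystallization.Theorems.FrustratedLawDichotomyGSCDensitySurgeryTest (energyDensity_eq_eStar)
open Summit.AtomisticToContinuum.Crystallization.Theorems.FrustratedLawDichotomyGSCSurgeryCertificates (not_isMuGSC_of_truncated_surgery)

variable {δ : ℝ} {X : Set E3} {ι : Type*} {l : Filter ι}

/-- **THE `e⋆`-FREE TRUNCATED SURGERY CERTIFICATE.**  `X ⊆ ℝ³` `δ`-separated with a van Hove family of finite clusters of energy per atom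
`→ μc`; surgery: remove the `m` distinct atoms `yf ⊆ X`, insert the `k` distinct atoms `R` off `X ∖ yf`; truncation radius `Rc ≥ δ`, `tf i` /
`tR i` the atoms of `X ∖ yf` within `Rc` of `yf i` / `R i`.  If
`[U(R) + Σ_i I_{≤Rc}(R i)] − [U(yf) + Σ_i I_{≤Rc}(yf i)] + (m + k)·T(δ, Rc) < μc·(k − m)`
then `X` is NOT an `e⋆`-μ-ground-state configuration of `V_LJ`. [folklore] -/
theorem not_isMuGSC_eStar_of_truncated_surgery_at_density [l.NeBot] (hδ : 0 < δ)
    (hsep : ∀ a ∈ X, ∀ b ∈ X, a ≠ b → δ ≤ dist a b)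
    (n : ι → ℕ) (xf : ∀ j, Fin (n j) → E3) (hinj : ∀ j, Function.Injective (xf j)) (hX : ∀ j, Set.range (xf j) ⊆ X)
    (hnpos : ∀ j, 0 < n j)
    (hI : Tendsto (fun j => (∑ i, ∑' y : ↥(X \ Set.range (xf j)), lennardJones (dist (xf j i) y)) / (n j : ℝ)) l (𝓝 0))
    {μc : ℝ} (hU : Tendsto (fun j => interactionEnergy lennardJones (xf j) / (n j : ℝ)) l (𝓝 μc))
    {m : ℕ} {yf : Fin m → E3} (hyf : Function.Injective yf) (hY : Set.range yf ⊆ X)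
    {k : ℕ} {R : Fin k → E3} (hR : Function.Injective R) (hdisj : Disjoint (Set.range R) (X \ Set.range yf))
    {Rc : ℝ} (hRc : δ ≤ Rc)
    (tf : Fin m → Finset E3) (htf : ∀ i, ∀ y : E3, y ∈ tf i ↔ y ∈ X \ Set.range yf ∧ dist (yf i) y ≤ Rc)
    (tR : Fin k → Finset E3) (htR : ∀ i, ∀ y : E3, y ∈ tR i ↔ y ∈ X \ Set.range yf ∧ dist (R i) y ≤ Rc)
    (hΔ : (interactionEnergy lennardJones R + ∑ i, ∑ y ∈ tR i, lennardJones (dist (R i) y)) -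
        (interactionEnergy lennardJones yf + ∑ i, ∑ y ∈ tf i, lennardJones (dist (yf i) y)) +
        ((m : ℝ) + k) * ((δ⁻¹ ^ 6 / 12 + 1 / 6) * (1024 / (δ ^ 3 * Rc ^ 3))) < μc * ((k : ℝ) - m)) :
    ¬ IsMuGSC lennardJones eStar X := by
  intro h
  have hμ : μc = eStar := energyDensity_eq_eStar h n xf hinj hX hnpos hI hU
  rw [hμ] at hΔ
  exact not_isMuGSC_of_truncated_surgery hδ hsep hyf hY hR hdisj hRc tf htf tR htR hΔ h

end Summit.AtomisticToContinuum.Crystallization.Theorems.FrustratedLawDichotomyGSCDensityTruncatedTest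

end
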